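import Literature.NumberTheory.LFunctions.HuxleyZeroDensity
import Literature.NumberTheory.LFunctions.ZeroDensityInghamHuxleyProofs
import Literature.NumberTheory.LFunctions.ZeroDensityGuthMaynardRange
import Literature.NumberTheory.LFunctions.ZeroDensityGuthMaynardWindow
import HarnessLib

/-!
# The Guth–Maynard `30/13` density theorem: assembly from Ingham, Huxley and the Guth–Maynard window

Trunk T-ANT (`Literature/NumberTheory/LFunctions`), family RH, statement **rh.S12**. First layer of
the decomposition of the named fact `Literature.NumberTheory.LFunctions.zeroDensity_thirty_thirteenths`
(`ZeroCounting.lean`: `N(σ, T) ≪_ε T^{(30/13)(1−σ)+ε}` for `1/2 ≤ σ ≤ 1`, i.e.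
`ZeroDensityEstimate (fun _ ↦ 30/13) (1/2)`), following L. Guth, J. Maynard, *New large value
estimates for Dirichlet polynomials*, Ann. of Math. (2) 203 (2026) 623–675 = arXiv:2405.20552, §1:

* Theorem 1.2 (zero density estimate): "`N(σ,T) ≤ T^{15(1−σ)/(3+5σ)+o(1)}`" — the tree's named fact
  `Literature.NumberTheory.LFunctions.zeroDensity_guth_maynard` (recorded on `7/10 ≤ σ ≤ 1`);
* the display following Theorem 1.2: "Combining this with Ingham's estimate when `σ ≤ 7/10`, we
  obtain `N(σ,T) ≤ T^{30(1−σ)/13+o(1)}`" — the target `zeroDensity_thirty_thirteenths`;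
* §13.1, first sentence of the proof of Theorem 1.2: "Theorem 1.2 follows from Ingham's result if
  `σ ≤ 7/10` and Huxley's result if `σ ≥ 8/10`, so we may assume that `σ ∈ [7/10, 8/10]`."

Everything in this file is PROVED; no named fact is introduced. The results are

* `Literature.NumberTheory.LFunctions.zeroDensity_thirty_thirteenths_of_ingham_of_guth_maynard` — the
  printed assembly: `zeroDensity_ingham → zeroDensity_guth_maynard → zeroDensity_thirty_thirteenths`
  (`3/(2−σ) ≤ 30/13 ⟺ σ ≤ 7/10` and `15/(3+5σ) ≤ 30/13 ⟺ σ ≥ 7/10`);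
* `Literature.NumberTheory.LFunctions.zeroDensity_thirty_thirteenths_of_guth_maynard` — the same with
  Ingham's theorem discharged by the tree's `zeroDensity_ingham_holds` (`ZeroDensityIngham.lean`), so
  that the named fact `zeroDensity_guth_maynard` is the only remaining input;
* `Literature.NumberTheory.LFunctions.zeroDensity_thirty_thirteenths_of_window` — the sharper reduction
  to what Guth–Maynard's new method proves in §13.1: the bound `N(σ,T) ≪_ε T^{15(1−σ)/(3+5σ)+ε}` on
  the WINDOW `7/10 ≤ σ ≤ 4/5` alone implies `zeroDensity_thirty_thirteenths`, the two ends being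
  covered unconditionally in the tree by Ingham's theorem (`zeroDensity_ingham_holds`, `σ ≤ 7/10`)
  and by Huxley's density theorem in the form of his monograph, Ch. 28 (28.19),
  `A(σ) ≤ (5σ−3)/(σ²+σ−1)` on `[3/4, 1]` (`Huxley1972_zeroDensity_holds`, `HuxleyZeroDensity.lean`),
  whose exponent is `≤ 30/13` exactly when `30σ² − 35σ + 9 ≥ 0`, in particular for `σ ≥ 4/5`
  (`huxley1972_exponent_le_thirty_thirteenths`). (Huxley's sharper `3/(3σ−1)` of Invent. Math. 15
  (1972), the "Huxley's result" of Guth–Maynard §13.1, is the tree's named fact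
  `Ivic1985_theorem11_1_huxley`; it is not needed for the exponent `30/13`.)

* `Literature.NumberTheory.LFunctions.isBigO_zetaZeroCountRe_window_of_wellSpaced` — the first and
  third paragraphs of §13.1 ("Clearly it suffices to show the bound of Theorem 1.2 for zeros with
  imaginary part in `[T,2T]`, since the result for `[0,T]` then follows by considering `T/2, T/4, …`
  in place of `T`"; "There are `O(log T)` non-trivial zeros `ρ = β+iγ` with `γ ∈ [t,t+1]` for any
  `t ∈ [T,2T]`. Therefore we can find a 1-separated set of points …"): the window bound follows from
  an eventual bound `C U^{15(1−σ)/(3+5σ)+η}` (every `η > 0`) for finite sets of zeros with `β ≥ σ`,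
  `U < γ ≤ 2U` and ordinates pairwise `≥ 1` apart, through the tree's proved counting layer
  (`ZeroDensity.wellSpacedBound_of_eventually`, `ZeroDensity.count_dyadic_le` with the unit-window
  count `exists_sum_zetaZeroWindow_le`, `ZeroDensity.isBigO_of_dyadic`), used verbatim as in
  `Huxley1972_zeroDensity_holds`;
* `Literature.NumberTheory.LFunctions.zeroDensity_thirty_thirteenths_of_wellSpaced` and
  `Literature.NumberTheory.LFunctions.zeroDensity_guth_maynard_of_wellSpaced` — consequently BOTH named
  facts, `zeroDensity_thirty_thirteenths` and `zeroDensity_guth_maynard` (Theorem 1.2 on the whole of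
  `[7/10, 1]`), follow from that single well-spaced count on the window `7/10 ≤ σ ≤ 4/5`; for the
  latter the clause `σ ≥ 4/5` is Huxley's `A(σ) ≤ 3/(3σ−1)`, PROVED in the tree
  (`Ivic1985_theorem11_1_huxley_holds`, `ZeroDensityInghamHuxleyProofs.lean`) and threaded through
  `zeroDensity_guth_maynard_of_window` (`ZeroDensityGuthMaynardRange.lean`).

* `Literature.NumberTheory.LFunctions.zeroDensity_thirty_thirteenths_of_largeValues` — **the named
  fact from Guth–Maynard's Theorem 1.1 alone**: the window hypothesis is supplied by
  `isBigO_zetaZeroCountRe_window_of_largeValues` (`ZeroDensityGuthMaynardWindow.lean`, which PROVES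
  §13.1 — zero detection, the power `k` of (13.1), removal of the real parts, Theorem 1.1 or the
  mean value theorem on `D̃^k`, the Type II count — with Theorem 1.1 as the explicit hypothesis
  `hLV`, the theorem as printed for `N ≤ T` and `T` large). An independent formalisation of the
  Type I/Type II counts of §13.1 with Theorem 1.1 as hypothesis is in `GuthMaynardZeroDetection.lean`.

What remains for the discharge `zeroDensity_thirty_thirteenths_holds` (and equally for
`zeroDensity_guth_maynard_holds`) is therefore exactly ONE published statement not yet in the tree:
Guth–Maynard's Theorem 1.1, the large values estimate
`R ≤ T^{o(1)}(N²V^{-2} + N^{18/5}V^{-4} + TN^{12/5}V^{-4})` (§§3–12 of the paper, resting on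
Heath-Brown's Theorem 1.6) — a statement about Dirichlet polynomials with no zeta zeros in it.

## References

* L. Guth, J. Maynard, *New large value estimates for Dirichlet polynomials*, Ann. of Math. (2) 203
  (2026), no. 2, 623–675; arXiv:2405.20552. §1 Thm. 1.2 and the display following it; §13.1.
* A. E. Ingham, *On the estimation of `N(σ, T)`*, Quart. J. Math. Oxford 11 (1940) 291–292.
* M. N. Huxley, *The Distribution of Prime Numbers*, Oxford 1972, Ch. 28, (28.19).
* A. Ivić, *The Riemann Zeta-Function*, Wiley 1985, Thm. 11.1.
-/

noncomputable section

open Filter Asymptotics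
open scoped Real Topology

namespace Literature.NumberTheory.LFunctions

/-! ## The three exponent inequalities -/

/-- Ingham's exponent is at most `30/13` up to `σ = 7/10`: `3/(2−σ) ≤ 30/13` for `σ ≤ 7/10`
(indeed `⟺`; Guth–Maynard §1: "Combining this with Ingham's estimate when `σ ≤ 7/10`").
[cite: GuthMaynard2024, §1, display following Thm. 1.2] -/
theorem ingham_exponent_le_thirty_thirteenths {σ : ℝ} (h₁ : σ ≤ 7 / 10) :
    3 / (2 - σ) ≤ 30 / 13 := by
  rw [div_le_div_iff₀ (by linarith) (by norm_num)]
  linarith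

/-- The Guth–Maynard exponent is at most `30/13` from `σ = 7/10` on: `15/(3+5σ) ≤ 30/13` for
`σ ≥ 7/10` (indeed `⟺`). [cite: GuthMaynard2024, §1, display following Thm. 1.2] -/
theorem guthMaynard_exponent_le_thirty_thirteenths {σ : ℝ} (h₀ : 7 / 10 ≤ σ) :
    15 / (3 + 5 * σ) ≤ 30 / 13 := by
  rw [div_le_div_iff₀ (by linarith) (by norm_num)]
  linarith

/-- Huxley's monograph exponent (28.19) is at most `30/13` from `σ = 4/5` on:
`(5σ−3)/(σ²+σ−1) ≤ 30/13` for `4/5 ≤ σ` (equivalently `30σ² − 35σ + 9 ≥ 0`, whose larger root is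
`(35 + √145)/60 = 0.784…`). [cite: Huxley1972, Ch. 28, eq. (28.19)] -/
theorem huxley1972_exponent_le_thirty_thirteenths {σ : ℝ} (h₀ : 4 / 5 ≤ σ) :
    (5 * σ - 3) / (σ ^ 2 + σ - 1) ≤ 30 / 13 := by
  have hden : 0 < σ ^ 2 + σ - 1 := by nlinarith
  rw [div_le_div_iff₀ hden (by norm_num)]
  nlinarith [mul_self_nonneg (σ - 4 / 5)]

/-! ## The assemblies -/

/-- **`zeroDensity_thirty_thirteenths` from Ingham and Guth–Maynard** — the assembly as printed in
Guth–Maynard §1: Theorem 1.2, `N(σ,T) ≤ T^{15(1−σ)/(3+5σ)+o(1)}` (here on `σ ≥ 7/10`, the named fact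
`zeroDensity_guth_maynard`), "combining this with Ingham's estimate when `σ ≤ 7/10`"
(`zeroDensity_ingham`, `A(σ) ≤ 3/(2−σ)`), gives `N(σ,T) ≤ T^{30(1−σ)/13+o(1)}` on `1/2 ≤ σ ≤ 1`,
since both exponents are `≤ 30/13` on their ranges with the common value `30/13` at `σ = 7/10`.
[cite: GuthMaynard2024, §1, Thm. 1.2 and the display following it] -/
theorem zeroDensity_thirty_thirteenths_of_ingham_of_guth_maynard (hI : zeroDensity_ingham)
    (hGM : zeroDensity_guth_maynard) : zeroDensity_thirty_thirteenths :=
  ZeroDensityEstimate.const_of_two hI hGM (fun _ _ h₁ ↦ ingham_exponent_le_thirty_thirteenths h₁)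
    fun _ h₀ _ ↦ guthMaynard_exponent_le_thirty_thirteenths h₀

/-- **`zeroDensity_thirty_thirteenths` from Guth–Maynard's Theorem 1.2 alone**: Ingham's theorem is
proved in the tree (`zeroDensity_ingham_holds`, `ZeroDensityIngham.lean`), so the named fact
`zeroDensity_guth_maynard` is the only remaining input of the printed assembly.
[cite: GuthMaynard2024, §1, Thm. 1.2 and the display following it] -/
theorem zeroDensity_thirty_thirteenths_of_guth_maynard (hGM : zeroDensity_guth_maynard) :
    zeroDensity_thirty_thirteenths :=
  zeroDensity_thirty_thirteenths_of_ingham_of_guth_maynard zeroDensity_ingham_holds hGM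

/-- **`zeroDensity_thirty_thirteenths` from the Guth–Maynard window alone** (Guth–Maynard §13.1:
"Theorem 1.2 follows from Ingham's result if `σ ≤ 7/10` and Huxley's result if `σ ≥ 8/10`, so we
may assume that `σ ∈ [7/10, 8/10]`"): if `N(σ,T) ≪_ε T^{15(1−σ)/(3+5σ)+ε}` for every
`7/10 ≤ σ ≤ 4/5`, then `N(σ,T) ≪_ε T^{(30/13)(1−σ)+ε}` for every `1/2 ≤ σ ≤ 1`. Unconditional
inputs from the tree: Ingham's theorem `zeroDensity_ingham_holds` on `[1/2, 7/10]` and Huxley's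
(28.19) `Huxley1972_zeroDensity_holds` on `[4/5, 1]` (`huxley1972_exponent_le_thirty_thirteenths`).
[cite: GuthMaynard2024, §13.1 (proof of Thm. 1.2, first paragraph)] -/
theorem zeroDensity_thirty_thirteenths_of_window
    (h : ∀ ε > 0, ∀ σ : ℝ, 7 / 10 ≤ σ → σ ≤ 4 / 5 →
      (fun T : ℝ ↦ (zetaZeroCountRe σ T : ℝ)) =O[atTop]
        fun T : ℝ ↦ T ^ (15 / (3 + 5 * σ) * (1 - σ) + ε)) :
    zeroDensity_thirty_thirteenths := by
  intro ε hε σ h₀ h₁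
  rcases le_total σ (7 / 10) with hσ | hσ
  · exact zeroDensity_ingham_holds.isBigO_of_le hε h₀ h₁ (ingham_exponent_le_thirty_thirteenths hσ)
  rcases le_total σ (4 / 5) with hσ' | hσ'
  · refine (h ε hε σ hσ hσ').trans (isBigO_rpow_rpow_atTop_of_le ?_)
    have := mul_le_mul_of_nonneg_right (guthMaynard_exponent_le_thirty_thirteenths hσ)
      (sub_nonneg.mpr h₁)
    linarith
  · exact Huxley1972_zeroDensity_holds.isBigO_of_le hε (by linarith) h₁
      (huxley1972_exponent_le_thirty_thirteenths hσ')

/-! ## The reduction to well-separated zeros at dyadic heights (§13.1, first and third paragraphs) -/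

/-- **Guth–Maynard's Theorem 1.2 on the window from the dyadic well-spaced count** (§13.1: "Clearly
it suffices to show the bound of Theorem 1.2 for zeros with imaginary part in `[T,2T]`, since the
result for `[0,T]` then follows by considering `T/2, T/4, …` in place of `T`", and "There are
`O(log T)` non-trivial zeros `ρ = β+iγ` with `γ ∈ [t,t+1]` for any `t ∈ [T,2T]`. Therefore we can
find a 1-separated set of points `(s_r)_{r ≤ R}` in `[T,2T]` … and the number `R` of points satisfies
`R ≳ N(σ,2T) − N(σ,T)`"). If for every `7/10 ≤ σ ≤ 4/5` and every `η > 0` there are `U₀ ≥ 1` and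
`C ≥ 0` such that every finite set of zeros `ρ = β + iγ` of `ζ` with `β ≥ σ`, `U < γ ≤ 2U`
(`U ≥ U₀`) and ordinates pairwise `≥ 1` apart has at most `C U^{15(1−σ)/(3+5σ)+η}` elements, then
`N(σ,T) ≪_ε T^{15(1−σ)/(3+5σ)+ε}` for every `7/10 ≤ σ ≤ 4/5` and every `ε > 0`. The passage from
well-separated zeros at dyadic heights to `N(σ,T)` is the tree's counting layer — representatives on
unit windows by the window count `exists_sum_zetaZeroWindow_le` (`ZeroDensity.count_dyadic_le`),
small heights by the trivial count (`ZeroDensity.wellSpacedBound_of_eventually`), and dyadic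
summation (`ZeroDensity.isBigO_of_dyadic`) — exactly as in `Huxley1972_zeroDensity_holds`.
[cite: GuthMaynard2024, §13.1 (proof of Thm. 1.2, first and third paragraphs)] -/
theorem isBigO_zetaZeroCountRe_window_of_wellSpaced
    (h : ∀ σ : ℝ, 7 / 10 ≤ σ → σ ≤ 4 / 5 → ∀ η : ℝ, 0 < η →
      ∃ U₀ C : ℝ, 1 ≤ U₀ ∧ 0 ≤ C ∧ ∀ U : ℝ, U₀ ≤ U → ∀ Z : Finset ℂ,
        (∀ ρ ∈ Z, riemannZeta ρ = 0 ∧ σ ≤ ρ.re ∧ U < ρ.im ∧ ρ.im ≤ 2 * U) →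
        (∀ ρ ∈ Z, ∀ ρ' ∈ Z, ρ ≠ ρ' → 1 ≤ |ρ.im - ρ'.im|) →
        (Z.card : ℝ) ≤ C * U ^ (15 / (3 + 5 * σ) * (1 - σ) + η))
    {ε : ℝ} (hε : 0 < ε) {σ : ℝ} (h₀ : 7 / 10 ≤ σ) (h₁ : σ ≤ 4 / 5) :
    (fun T : ℝ ↦ (zetaZeroCountRe σ T : ℝ)) =O[atTop]
      fun T : ℝ ↦ T ^ (15 / (3 + 5 * σ) * (1 - σ) + ε) := by
  have hε2 : 0 < ε / 2 := by linarith
  obtain ⟨U₀, C, hU₀, hC0, hws⟩ := h σ h₀ h₁ (ε / 2) hε2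
  have hA0 : 0 ≤ 15 / (3 + 5 * σ) * (1 - σ) :=
    mul_nonneg (div_nonneg (by norm_num) (by linarith)) (by linarith)
  have hκ0 : 0 < 15 / (3 + 5 * σ) * (1 - σ) + ε / 2 := by linarith
  obtain ⟨C', hC'0, hwsb⟩ :=
    ZeroDensity.wellSpacedBound_of_eventually (σ := σ) (κ := 15 / (3 + 5 * σ) * (1 - σ) + ε / 2)
      (by linarith) hκ0.le hU₀ hC0 hws
  obtain ⟨Cw, hCw0, hCw⟩ := LFunctions.exists_sum_zetaZeroWindow_le
  have hdy : ∀ U : ℝ, 1 ≤ U → (zetaZeroCountRe σ (2 * U) : ℝ) - zetaZeroCountRe σ U ≤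
      (2 * C' * Cw) * U ^ (15 / (3 + 5 * σ) * (1 - σ) + ε / 2) * Real.log (2 * U + 3) := by
    intro U hU
    have := ZeroDensity.count_dyadic_le (by linarith) hwsb hCw hU
    calc (zetaZeroCountRe σ (2 * U) : ℝ) - zetaZeroCountRe σ U
        ≤ 2 * C' * U ^ (15 / (3 + 5 * σ) * (1 - σ) + ε / 2) * (Cw * Real.log (2 * U + 3)) := this
      _ = (2 * C' * Cw) * U ^ (15 / (3 + 5 * σ) * (1 - σ) + ε / 2) * Real.log (2 * U + 3) := by
          ring
  have hbig := ZeroDensity.isBigO_of_dyadic hκ0 (by positivity) hdy hε2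
  refine hbig.trans (isBigO_rpow_rpow_atTop_of_le (le_of_eq ?_))
  ring

/-- **`zeroDensity_thirty_thirteenths` from the dyadic well-spaced count on the window** — the
composite of `isBigO_zetaZeroCountRe_window_of_wellSpaced` (§13.1, first and third paragraphs) and
`zeroDensity_thirty_thirteenths_of_window` (Ingham below `7/10`, Huxley (28.19) above `4/5`, both
proved in the tree). The hypothesis is what §13.1 derives from Theorem 1.1 by the zero-detecting
method; it is the only input of the `30/13` theorem not proved in the tree.
[cite: GuthMaynard2024, §1 (display following Thm. 1.2) and §13.1] -/
theorem zeroDensity_thirty_thirteenths_of_wellSpaced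
    (h : ∀ σ : ℝ, 7 / 10 ≤ σ → σ ≤ 4 / 5 → ∀ η : ℝ, 0 < η →
      ∃ U₀ C : ℝ, 1 ≤ U₀ ∧ 0 ≤ C ∧ ∀ U : ℝ, U₀ ≤ U → ∀ Z : Finset ℂ,
        (∀ ρ ∈ Z, riemannZeta ρ = 0 ∧ σ ≤ ρ.re ∧ U < ρ.im ∧ ρ.im ≤ 2 * U) →
        (∀ ρ ∈ Z, ∀ ρ' ∈ Z, ρ ≠ ρ' → 1 ≤ |ρ.im - ρ'.im|) →
        (Z.card : ℝ) ≤ C * U ^ (15 / (3 + 5 * σ) * (1 - σ) + η)) :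
    zeroDensity_thirty_thirteenths :=
  zeroDensity_thirty_thirteenths_of_window fun _ε hε _σ h₀ h₁ ↦
    isBigO_zetaZeroCountRe_window_of_wellSpaced h hε h₀ h₁

/-- **`zeroDensity_guth_maynard` (Theorem 1.2 on `7/10 ≤ σ ≤ 1`) from the same dyadic well-spaced
count on the window** — the composite of `isBigO_zetaZeroCountRe_window_of_wellSpaced` with
`zeroDensity_guth_maynard_of_window` (`ZeroDensityGuthMaynardRange.lean`), the clause `σ ≥ 4/5`
("Huxley's result (1.4)", `N(σ,T) ≤ T^{3(1−σ)/(3σ−1)+o(1)}`) being discharged by the tree's proved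
`Ivic1985_theorem11_1_huxley_holds` (`ZeroDensityInghamHuxleyProofs.lean`). So the two named facts
`zeroDensity_guth_maynard` and `zeroDensity_thirty_thirteenths` have one and the same remaining
input. [cite: GuthMaynard2024, Thm. 1.2 and §13.1 (first paragraph)] -/
theorem zeroDensity_guth_maynard_of_wellSpaced
    (h : ∀ σ : ℝ, 7 / 10 ≤ σ → σ ≤ 4 / 5 → ∀ η : ℝ, 0 < η →
      ∃ U₀ C : ℝ, 1 ≤ U₀ ∧ 0 ≤ C ∧ ∀ U : ℝ, U₀ ≤ U → ∀ Z : Finset ℂ,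
        (∀ ρ ∈ Z, riemannZeta ρ = 0 ∧ σ ≤ ρ.re ∧ U < ρ.im ∧ ρ.im ≤ 2 * U) →
        (∀ ρ ∈ Z, ∀ ρ' ∈ Z, ρ ≠ ρ' → 1 ≤ |ρ.im - ρ'.im|) →
        (Z.card : ℝ) ≤ C * U ^ (15 / (3 + 5 * σ) * (1 - σ) + η)) :
    zeroDensity_guth_maynard :=
  zeroDensity_guth_maynard_of_window
    (fun _ε hε _σ h₀ h₁ ↦ isBigO_zetaZeroCountRe_window_of_wellSpaced h hε h₀ h₁)
    Ivic1985_theorem11_1_huxley_holds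

/-! ## The named fact from Guth–Maynard's Theorem 1.1 alone -/

/-- **`zeroDensity_thirty_thirteenths` from Guth–Maynard's Theorem 1.1.** If the large values
estimate of Theorem 1.1 holds — hypothesis `hLV`, the theorem as printed ("Suppose `(b_n)` is a
sequence of complex numbers with `|b_n| ≤ 1`, and `(t_r)_{r≤R}` is a sequence of `1`-separated points
in `[0, T]` such that `|∑_{n=N}^{2N} b_n n^{it_r}| ≥ V` for all `r ≤ R`. Then
`R ≤ T^{o(1)}(N²V^{-2} + N^{18/5}V^{-4} + TN^{12/5}V^{-4})`"), with `T^{o(1)}` read as "for every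
`ε > 0`, `≤ C(ε) T^ε` for `T ≥ T₀(ε)`" and in the range `N ≤ T` — then
`N(σ, T) ≪_ε T^{(30/13)(1−σ)+ε}` for every `1/2 ≤ σ ≤ 1`. The window `7/10 ≤ σ ≤ 4/5` is
`isBigO_zetaZeroCountRe_window_of_largeValues` (`ZeroDensityGuthMaynardWindow.lean`, §13.1 of the
paper, PROVED modulo `hLV`); the two ends are Ingham's and Huxley's theorems, PROVED in the tree
(`zeroDensity_thirty_thirteenths_of_window`). So the named fact is reduced to exactly one
published statement not yet formalised, Theorem 1.1 of the same paper.
[cite: GuthMaynard2024, Thm. 1.1, Thm. 1.2, the display following Thm. 1.2, and §13.1] -/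
theorem zeroDensity_thirty_thirteenths_of_largeValues
    (hLV : ∀ ε : ℝ, 0 < ε → ∃ C T₀ : ℝ, ∀ T : ℝ, T₀ ≤ T →
      ∀ (N : ℕ) (b : ℕ → ℂ) (V : ℝ) (W : Finset ℝ), 1 ≤ N → (N : ℝ) ≤ T →
      (∀ n, ‖b n‖ ≤ 1) → 0 < V → (∀ t ∈ W, 0 ≤ t ∧ t ≤ T) →
      (∀ t ∈ W, ∀ t' ∈ W, t ≠ t' → 1 ≤ |t - t'|) →
      (∀ t ∈ W, V ≤ ‖∑ n ∈ Finset.Icc N (2 * N), b n * (n : ℂ) ^ ((t : ℂ) * Complex.I)‖) →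
      (W.card : ℝ) ≤ C * T ^ ε * ((N : ℝ) ^ 2 * V⁻¹ ^ 2 + (N : ℝ) ^ (18 / 5 : ℝ) * V⁻¹ ^ 4 +
        T * (N : ℝ) ^ (12 / 5 : ℝ) * V⁻¹ ^ 4)) :
    zeroDensity_thirty_thirteenths :=
  zeroDensity_thirty_thirteenths_of_window fun _ε hε _σ h₀ h₁ ↦
    isBigO_zetaZeroCountRe_window_of_largeValues hLV hε h₀ h₁

/-- The same from Theorem 1.2 itself in the tree's form: `zeroDensity_guth_maynard_of_largeValues`
(`ZeroDensityGuthMaynardWindow.lean`) composed with the printed assembly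
`zeroDensity_thirty_thirteenths_of_guth_maynard` — the literal route of §1 of the paper
("Combining this with Ingham's estimate when `σ ≤ 7/10`"). [cite: GuthMaynard2024, §1, display following Thm. 1.2] -/
theorem zeroDensity_thirty_thirteenths_of_largeValues'
    (hLV : ∀ ε : ℝ, 0 < ε → ∃ C T₀ : ℝ, ∀ T : ℝ, T₀ ≤ T →
      ∀ (N : ℕ) (b : ℕ → ℂ) (V : ℝ) (W : Finset ℝ), 1 ≤ N → (N : ℝ) ≤ T →
      (∀ n, ‖b n‖ ≤ 1) → 0 < V → (∀ t ∈ W, 0 ≤ t ∧ t ≤ T) →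
      (∀ t ∈ W, ∀ t' ∈ W, t ≠ t' → 1 ≤ |t - t'|) →
      (∀ t ∈ W, V ≤ ‖∑ n ∈ Finset.Icc N (2 * N), b n * (n : ℂ) ^ ((t : ℂ) * Complex.I)‖) →
      (W.card : ℝ) ≤ C * T ^ ε * ((N : ℝ) ^ 2 * V⁻¹ ^ 2 + (N : ℝ) ^ (18 / 5 : ℝ) * V⁻¹ ^ 4 +
        T * (N : ℝ) ^ (12 / 5 : ℝ) * V⁻¹ ^ 4)) :
    zeroDensity_thirty_thirteenths :=
  zeroDensity_thirty_thirteenths_of_guth_maynard (zeroDensity_guth_maynard_of_largeValues hLV)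

end Literature.NumberTheory.LFunctions
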